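import Summits.QuantumFields.BalabanUV.T4Continuum.Support.NE9CurChartOneInstanceSmallField
import Summits.QuantumFields.BalabanUV.T4Continuum.Support.NE9CurOfB11Chart
import Summits.QuantumFields.BalabanUV.T4Continuum.Support.NE9CurChartOneInstanceUniformBall

/-!
# NE9CurOfOneInstanceChart — THE NODE FED: the T23 «ONE INSTANCE» chart of `cur U` (`W80` in the W-slot at the T-slot's own `(H(U), C(U), ε_C)`,
# the J-79 term IN the linear slot `Λ := −(𝔊(U) ∘L L_J)`), read per localization domain in the END's chart space, DISCHARGES the three
# background-map binders (Ψ1)–(Ψ3) of the `cur` species' leaf A3 `NE9CurveFromBackgroundMap.cpieceResponse_compCur` BY NAME — with `hpos`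
# displayed (§2) AND with `hpos(U)` PRODUCED on the small-field set of a fixed lattice (§3: the desk's T24 ∧ T25 in ONE object); the pub-balaban
# NE9 desk's ARMED trigger T25 «THE NODE FED» (PRICING-NE9 v32 §H ∕ v34: «`NE9CurveFromBackgroundMap` … fed BY THE INSTANCE WITH the J-term … or
# the instance composed in») on route R2′ of `t4/ROUTES-NE9.md`; cell `pub-balaban`, T4-DAG §2 node U3 ∕ §6 NE9; NE9 crux-team leaf lineage
# `b2b-balaban-t4-ne9-formalise-leaf-05`, generation 67 (the lineage that wrote `NE9CurveFromBackgroundMap`, gen 5); Summits-side sequel of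
# `NE9CurChartOneInstanceSmallField` under this seat's INTERFACE REQUEST NE9 (T24∕T25); nothing printed asserted

HONEST FRAMING (T4-DAG PAGE 1).  Rung (B)+1 of the FINITE-VOLUME T⁴ programme — NOT infinite volume, NOT a mass gap, NOT the Clay problem.  NE9
(`T4OutputRate.NE9` ∧ `FadingMemory`) is a cell NEW ESTIMATE, NOT PRINTED in [I] = [Balaban1987RG1] (CMP **109**), [II] = [Balaban1988RG2Cluster]
(CMP **116**), and NOT PROVED here («NE9 ⇐ the named binders»; spine PROVED 0∕9).  HONEST DEPENDENCY (cell line, verbatim): continuum YM on T⁴ ⇐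
BetaPertH ∧ nine spine estimates (0/9 proved); BetaPertH ⇐ (D1) ∧ (D4) ∧ CAP+tail; G-an2-4 gates asym, D1 and NE2/3/4.  The `cur U` OBJECT is ONE
item of the MODEL O-NE9-1 (species (a) data): the END's `act` ∕ `ker` halves, the ray species' binders on the SHIFT FIELD, the window family's
analyticity + (1.18), the counts and NEEDS-COORDINATOR #5 are untouched and stay DISPLAYED exactly as in `cpieceResponse_compCur`.

WHERE THIS SITS.  The owner's `NE9CurOfB11Chart.cpieceResponse_compCur_of_twoSchemes` (gen 59) fed leaf A3 with the (174)∘(47) chart of the two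
ABSTRACT contraction schemes (`Λ := 0`, letters `𝒢, W, H, C, H₁` free, radii as INPUT letters).  THIS FILE feeds it with the lineage's one-instance
chart AT THE CHAIN's LETTERS — `𝔊(U) := frakGLatticeCLM …`, `H(U) := H1LatticeCLM …`, `C(U) := Cc …`, `W := W80 ρ τc U H(U) C(U) ε_C J Δπ`,
`Λ := −(𝔊(U) ∘L LJ ρ τc H(U) C(U) J)` — whose radii are PRODUCED ((B) `NE9CurChartOneInstance.cur_chart_exists_oneInstance`), and, on the small-field
set, whose positivity is PRODUCED too ((A′) `NE9CurChartOneInstanceSmallField`, from the owner's [B9] Thm 3.11 `B9Thm311SmallFieldClosed`).  The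
READING is the owner's: two continuous linear letters per domain, `ιr X : E →L[ℂ] |·|_{(−0)}` (shift-field direction read as a B-field; [II]
(1.1)∕(1.23)) and `πr X : (115) →L[ℂ] E` (restriction to `X` + chart coordinates of `U^c_j(X, α₀, α₁)`; [I] (3.53) p. 280), with two ball
inclusions (`NE9CurOfB11Chart.triple_read`).

WHAT THIS FILE PROVES (0 def, 0 sorry, axioms standard).
* §1 **`cpieceResponse_compCur_of_chart`** (generic): ANY map `Φ : ℬ → 𝒴` with (Ψ1)–(Ψ3) on `ball 0 R_b → ball 0 R′`, read per domain by `ιr`, `πr`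
  with the two ball inclusions, discharges `cpieceResponse_compCur`'s `hΨan ∕ hΨmaps ∕ hΨ0` for `Ψ X := πr X ∘ Φ ∘ ιr X`; every other binder and
  the conclusion VERBATIM [folklore].
* §2 **`cpieceResponse_compCur_of_oneInstance`** — AT THE CHAIN's LETTERS, `hpos` DISPLAYED (ABSOLUTE RULE): given (B) §3's binders and
  `‖𝔊(U) ∘L L_J‖ < 1`, THERE ARE `a_C ε_C ε₄ R_b R′ > 0` with the Sect. C `Regime` at `(H(U), C(U), a_C, ε_C)` such that FOR ALL readings `ιr`, `πr`
  with `ιr X (ball 0 (D.R X)) ⊆ ball 0 R_b`, `πr X (ball 0 R′) ⊆ ball 0 (R₁ X)`, the conclusion of `cpieceResponse_compCur` holds for the composite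
  datum `D.compCur Ψ R₁`, `Ψ X e := πr X (chartHB 𝔊(U) (−(𝔊(U) ∘L L_J)) (W80 … ε_C J Δπ) 0 (A′ ↦ A′ + solA H(U) 0 C(U) 0 ε_C A′) ε₄ H(U) (ιr X e))`
  — the node FED by the instance WITH the J-term.
* §3 **`cpieceResponse_compCur_of_oneInstance_smallField`** — T24 ∧ T25: `∃ ε₃ > 0` such that for EVERY background `U` of E162's data with
  `‖U(b) − 1‖ ≤ ε ≤ ε₃` and `hRS`, all (L3) letters: `∃ hpos` (PRODUCED) and §2's conclusion at that `hpos`.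
* §4 (v1.1, gen 68, APPEND-ONLY) **`cpieceResponse_compCur_of_oneInstance_uniform_smallJ`** — §3 ON ONE PAIR OF BALLS: the radii `a_C ε_C ε₄ R_b R′`
  and a current threshold `j₁` BEFORE `∀ U` (this lineage's `NE9CurChartOneInstanceUniformBall.cur_chart_exists_oneInstance_smallField_uniform_smallJ`),
  so the readings' ball inclusions refer to FIXED numbers; no `‖𝔊(U) ∘L L_J‖ < 1` displayed (`‖J‖ ≤ j₁`, `‖Δπ‖ ≤ M_Δ` instead).
DISGUISE TEST: composition with linear maps + one application by name ((B) ∕ (A′) of this lineage, the owner's `triple_read`, this lineage's gen-5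
`cpieceResponse_compCur`); no inequality of the series proved (radii, `ε₃`, `q_c := 64·(4·clipd)·N̄` are finite-lattice ∕ displayed numbers); NOT
claimed: that Bałaban's 𝐇_k, U_j(□₀, exp iB), U^c_j meet the reading's two ball inclusions (O-NE9-1 ∕ O-NE9-5); the Λ-road is ONE of T23's two
admissible placements — the chain's road stays the OWNER's decision; not NE9.
References (TYPES ∕ loci only): [Balaban1985Variational] (47) p. 285, (78)–(80) p. 290, (84)–(90) pp. 290–291, (143) p. 300, (174)–(175) p. 305;
[Balaban1985BackgroundPropagators] Thm 3.11 p. 416, (3.126) p. 420; [Balaban1987RG1] (3.37) p. 277, Lemma 4 (3.53)–(3.54) p. 280; [Balaban1988RG2Cluster]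
(1.1) p. 3, (1.21)–(1.25) p. 7.  Imports `NE9CurChartOneInstanceSmallField` (this lineage gen 67) and `NE9CurOfB11Chart` (owner gen 59) ONLY; modifies
nothing; no END re-wired.  Value = route-R2′'s one-instance object reaches species (a)'s leaf A3 in the kernel (desk T25), NOT summit progress.
-/

noncomputable section

open scoped BigOperators InnerProductSpace
open Metric Set

namespace Summit.QuantumFields.BalabanUV.T4Continuum.NE9CurOfOneInstanceChart

open Literature.MathematicalPhysics.QuantumFieldTheory.Balaban1983to89
open Literature.MathematicalPhysics.QuantumFieldTheory.Balaban1983to89.T4OutputRate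
open Literature.MathematicalPhysics.QuantumFieldTheory.Balaban1983to89.T4HistoryLipschitzRecursion
open Literature.MathematicalPhysics.QuantumFieldTheory.Balaban1983to89.T4HistoryLipschitzSegment
open Summit.QuantumFields.BalabanUV.T4Continuum.NE9Lemma1PieceClass
open Summit.QuantumFields.BalabanUV.T4Continuum.NE9Lemma1RemainderSpecies
open Summit.QuantumFields.BalabanUV.T4Continuum.NE9Lemma1CurveSpecies
open Summit.QuantumFields.BalabanUV.T4Continuum.NE9CurveFromBackgroundMap
open Summit.QuantumFields.BalabanUV.T4Continuum.NE9ComplexEncoding (doubleCarriers)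
open Summit.QuantumFields.BalabanUV.T4Continuum.NE9CurOfB11Chart (triple_read)
open B11Eq103H1Complex B11Eq115Space B11Eq174Chart
open B11Eq111FrakG (nabla115)
open B9Eq319QprimeTorus (fineP)
open B9SectCLatticeCarrier (Bond)
open B4Sect5Torus (TSite)
open B7Prop1Explicit (U1 Wcx boxVec)
open B9Eq315QTorus (perCfg cornerSite QtorusW laplaceAofBackground)
open B9Eq315QTorusOnto (QtorusW_surjective)
open B9Eq310HessianOperator (adTransportW)
open B11Eq44COperatorTorus (Cc)
open B11Eq63V0GroupCurrent (curV0)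
open B11Eq80Current (W80)
open B11Eq79LinearTerm (LJ)
open Summit.QuantumFields.BalabanUV.T4Continuum.NE9CurChartOneInstance (cur_chart_exists_oneInstance)
open Summit.QuantumFields.BalabanUV.T4Continuum.NE9CurChartOneInstanceSmallField (cur_chart_exists_oneInstance_smallField)

/-! ## §1 Generic: ANY chart with (Ψ1)–(Ψ3), read per domain, feeds `cpieceResponse_compCur` -/

variable {C : Carriers} {E : Type} [NormedAddCommGroup E] [NormedSpace ℂ E] {ι' αι β γ δ : Type} [DecidableEq δ]

/-- **LEAF A3 OF THE `cur` SPECIES FOR ANY CHART WITH (Ψ1)–(Ψ3), READ PER DOMAIN IN THE END's CHART SPACE.**  If `Φ : ℬ → 𝒴` is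
`DifferentiableOn ℂ` on `ball 0 R_b`, maps it into `ball 0 R′` and fixes `0`, and per localization domain `X` two continuous linear readings
`ιr X : E →L[ℂ] ℬ` (`ball 0 (D.R X) ↦ ball 0 R_b`) and `πr X : 𝒴 →L[ℂ] E` (`ball 0 R′ ↦ ball 0 (R₁ X)`) are given, then the background-map family
`Ψ X := πr X ∘ Φ ∘ ιr X` satisfies (Ψ1)–(Ψ3) (`NE9CurOfB11Chart.triple_read`) and the conclusion of `NE9CurveFromBackgroundMap.cpieceResponse_compCur`
holds for the composite datum `D.compCur Ψ R₁` — every other binder of that theorem (the ray datum's `RemData.Admissible`, `0 < dirB`, (d1) `hcont`,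
(d2) `hlip`, `hhalf`, the window family analytic on the `R₁`-balls with (1.18) `TermSize`, the counts) VERBATIM; `qc := 64·(4·clipd)·N̄`. [folklore] -/
theorem cpieceResponse_compCur_of_chart {ℬ 𝒴 : Type*} [NormedAddCommGroup ℬ] [NormedSpace ℂ ℬ] [NormedAddCommGroup 𝒴] [NormedSpace ℂ 𝒴]
    {Φ : ℬ → 𝒴} {Rb R' : ℝ} (hΦ1 : DifferentiableOn ℂ Φ (ball 0 Rb)) (hΦ2 : MapsTo Φ (ball 0 Rb) (ball 0 R')) (hΦ3 : Φ 0 = 0)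
    {D : RemData C E ι' αι β γ δ} {R₁ : C.Dom → ℝ} (ιr : C.Dom → (E →L[ℂ] ℬ)) (πr : C.Dom → (𝒴 →L[ℂ] E))
    (hιr : ∀ X, MapsTo (ιr X) (ball 0 (D.R X)) (ball 0 Rb)) (hπr : ∀ X, MapsTo (πr X) (ball 0 R') (ball 0 (R₁ X)))
    {ℓ : ℕ → ℕ → ℝ} {cdir d0 : ℝ} (hD : D.Admissible ℓ cdir d0) (hdirB : ∀ k s y a b x, 0 < D.dirB k s y a b x)
    {Ef : Functional (doubleCarriers C) E} {Wd : Set (ℕ → ℝ)} {κw : ℝ} {N : ℕ → ℝ} {Nbar clipd : ℝ}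
    (hE : ∀ g ∈ Wd, Ef g ∈ analyticClass R₁) (hT : TermSize Ef Wd κw N) (hN0 : ∀ j, 0 ≤ N j) (hNb : ∀ j, N j ≤ Nbar)
    (hclipd : 0 ≤ clipd) (hcdir : 0 < cdir) (hℓ : ∀ k j, 0 < ℓ k j) (hhalf : ∀ k j, cdir * ℓ k j < 1 / 2)
    (hcont : ∀ (k : ℕ) (s : ℕ → ℝ) (y : ι') (a : αι) (b : β) (x : (doubleCarriers C).Dom),
      ContinuousOn (fun p : ℂ × ((δ → ℝ) × (δ → ℂ)) => D.dir k s y a b x p.1 p.2.1 p.2.2)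
        (sphere (0:ℂ) (D.r k) ×ˢ {q | OnContour D.κ₁ (D.cubes k y a b) q.1 q.2}))
    (hlip : ∀ g ∈ Wd, ∀ g' ∈ Wd, ∀ (k : ℕ) (y : ι'), ∀ a ∈ D.S0 k y, ∀ b ∈ D.SY k y a, ∀ (j : ℕ), ∀ x ∈ D.src k y a j,
      ∀ t ∈ sphere (0:ℂ) (D.r k), ∀ (s' : δ → ℝ) (σ' : δ → ℂ), OnContour D.κ₁ (D.cubes k y a b) s' σ' →
        ‖D.dir k g y a b x t s' σ' - D.dir k g' y a b x t s' σ'‖ ≤ clipd * (cdir * ℓ k j * D.R x.1) * |g k - g' k|) :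
    let Ψ : C.Dom → E → E := fun X e => πr X (Φ (ιr X e))
    ∀ g ∈ Wd, ∀ g' ∈ Wd, ∀ (k : ℕ) (y : ι'), ∀ a ∈ (D.compCur Ψ R₁).toC.S0 k y, ∀ b ∈ (D.compCur Ψ R₁).toC.SY k y a,
      ∀ (j : ℕ), ∀ x ∈ (D.compCur Ψ R₁).toC.src k y a j,
      |(D.compCur Ψ R₁).toC.piece k g y a b x (Ef g) - (D.compCur Ψ R₁).toC.piece k g' y a b x (Ef g)| ≤
        (D.compCur Ψ R₁).Kp cdir k y * (64 * (4 * clipd) * Nbar) * ℓ k j ^ 5 * Real.exp (-(κw * (doubleCarriers C).d x)) *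
          Real.exp (-(1 / 8) * ((D.compCur Ψ R₁).κ₁ - 1) * (D.compCur Ψ R₁).toC.dY k y + (1 / 8) * (D.compCur Ψ R₁).κ₁ * d0 -
            (1 / 2) * ((D.compCur Ψ R₁).κ₁ - 1) * (D.compCur Ψ R₁).toC.vol k y a b) *
            |g k - g' k| := by
  intro Ψ
  have htr : ∀ X, DifferentiableOn ℂ (Ψ X) (ball 0 (D.R X)) ∧ MapsTo (Ψ X) (ball 0 (D.R X)) (ball 0 (R₁ X)) ∧ Ψ X 0 = 0 :=
    fun X => triple_read hΦ1 hΦ2 hΦ3 (ιr X) (πr X) (hιr X) (hπr X)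
  exact cpieceResponse_compCur hD hdirB (fun X => (htr X).1) (fun X => (htr X).2.1) (fun X => (htr X).2.2) hE hT hN0 hNb hclipd
    hcdir hℓ hhalf hcont hlip

/-! ## §2 AT THE CHAIN's LETTERS: leaf A3 FED by the one-instance chart WITH the J-term (`hpos` displayed) -/

set_option maxRecDepth 8192 in
/-- **THE NODE FED BY THE INSTANCE WITH THE J-TERM** (desk T25).  For a background `U` on the torus `T_{L·m}` with E162's displayed data, the
fibre∕trace readings, weights, the DISPLAYED positivity `hpos` of the assembled `Δ_a(U)` ([Balaban1985BackgroundPropagators] Thm 3.11, ABSOLUTE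
RULE), `1 ≤ lev₀`, the (L3) letters `ρ`, `τc`, `J`, `Δπ` of `W80` with the V₀-slot `hqV`, and — at `H(U) := H1LatticeCLM …`, `𝔊(U) := frakGLatticeCLM …`,
`C(U) := Cc …` — the smallness `‖𝔊(U) ∘L L_J‖ < 1`; and for a ray datum `D` with the END's binder list VERBATIM (`RemData.Admissible`, `0 < dirB`,
(d1) `hcont`, (d2) `hlip`, `hhalf`, the window family `Ef` analytic on the `R₁`-balls with (1.18) `TermSize`, the counts): THERE ARE
`a_C ε_C ε₄ R_b R′ > 0` with the Sect. C `Regime` of (47) at `(H(U), C(U), a_C, ε_C)` such that for ALL per-domain readings `ιr X : E →L[ℂ] |·|_{(−0)}`,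
`πr X : (115) →L[ℂ] E` with `ιr X (ball 0 (D.R X)) ⊆ ball 0 R_b` and `πr X (ball 0 R′) ⊆ ball 0 (R₁ X)`, the conclusion of
`NE9CurveFromBackgroundMap.cpieceResponse_compCur` holds for the composite datum `D.compCur Ψ R₁` with
`Ψ X e := πr X (chartHB 𝔊(U) (−(𝔊(U) ∘L LJ ρ τc H(U) C(U) J)) (W80 ρ τc U H(U) C(U) ε_C J Δπ) 0 (A′ ↦ A′ + solA H(U) 0 C(U) 0 ε_C A′) ε₄ H(U) (ιr X e))`
— (B)'s `cur_chart_exists_oneInstance` composed into §1. [folklore] -/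
theorem cpieceResponse_compCur_of_oneInstance {d : ℕ} (L : ℕ) [NeZero L] (m : Fin d → ℕ) [∀ i, NeZero (fineP L m i)] (hL : 1 ≤ L)
    {𝔸 : Type*} [NormedRing 𝔸] [NormedAlgebra ℂ 𝔸] [CompleteSpace 𝔸] [NormOneClass 𝔸] [StarRing 𝔸] [StarModule ℂ 𝔸] [FiniteDimensional ℂ 𝔸]
    {W : Type*} [NormedAddCommGroup W] [InnerProductSpace ℂ W] [FiniteDimensional ℂ W] (φ : W ≃ₗ[ℂ] 𝔸) (τ : 𝔸 →ₗ[ℂ] ℂ)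
    {η : ℝ} [Fact (0 < (L : ℝ))] [Fact (0 < η)] {lev₀ : Bond d (fineP L m) → ℕ} {levB : Bond d m → ℕ} (lev₁ : Bond d (fineP L m) × Fin d → ℕ)
    (hlev : ∀ b, 1 ≤ lev₀ b)
    (U : Bond d (fineP L m) → 𝔸ˣ) {α : ℝ} (hα : α ≤ 1 / 128) (hα1 : α ≤ 1 / 64)
    (hU1 : ∀ (x : B7Prop1Explicit.Site d) (κ : Fin d), perCfg (fineP L m) U x κ ∈ U1 𝔸)
    (hreg : ∀ (y : TSite d m) (κ : Fin d) (r : Fin d → Fin L),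
      ‖((Wcx L (perCfg (fineP L m) U) (cornerSite L y) κ (boxVec L r) : 𝔸ˣ) : 𝔸) - 1‖ ≤ α)
    (hαL : 50 * (d + 1) * α * (L : ℝ) ^ d ≤ 1 / 2)
    {c₀ c₁ : ℝ} [Fact (0 < c₀)] [Fact (0 < c₁)] (a : ℝ)
    (hpos : ∀ x : BondL2K ℂ d (fineP L m) c₀ W, x ≠ 0 →
      0 < RCLike.re (inner ℂ x (laplaceAofBackground L m hL φ U hα1 hU1 hreg τ η (c₀ := c₀) (c₁ := c₁) a x)))
    -- the (L3) letters of `W80` and the V₀-group's slot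
    (ρ : (𝔸 →L[ℂ] ℂ) →L[ℂ] 𝔸) (τc : 𝔸 →L[ℂ] ℂ) {CV RV : ℝ} (hCV : 0 ≤ CV) (hRV : 0 < RV)
    (hqV : ∀ Y : Space115 (L : ℝ) η lev₀ lev₁ (nabla115 η U), ‖Y‖ < RV →
      ‖curV0 (lev₁ := lev₁) (Dc := nabla115 η U) ρ τc U Y‖ ≤ CV * ‖Y‖ ^ 2)
    (J : NegSize (L : ℝ) η lev₀ 3 𝔸) (Δπ : Space115 (L : ℝ) η lev₀ lev₁ (nabla115 η U) →L[ℂ] NegSize (L : ℝ) η lev₀ 3 𝔸)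
    -- the END's binders of `cpieceResponse_compCur`, verbatim (its `hpos` is `hdirB` here; its `W`, `κ`, `R'` are `Wd`, `κw`, `R₁`)
    {D : RemData C E ι' αι β γ δ} {R₁ : C.Dom → ℝ}
    {ℓ : ℕ → ℕ → ℝ} {cdir d0 : ℝ} (hD : D.Admissible ℓ cdir d0) (hdirB : ∀ k s y a b x, 0 < D.dirB k s y a b x)
    {Ef : Functional (doubleCarriers C) E} {Wd : Set (ℕ → ℝ)} {κw : ℝ} {N : ℕ → ℝ} {Nbar clipd : ℝ}
    (hE : ∀ g ∈ Wd, Ef g ∈ analyticClass R₁) (hT : TermSize Ef Wd κw N) (hN0 : ∀ j, 0 ≤ N j) (hNb : ∀ j, N j ≤ Nbar)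
    (hclipd : 0 ≤ clipd) (hcdir : 0 < cdir) (hℓ : ∀ k j, 0 < ℓ k j) (hhalf : ∀ k j, cdir * ℓ k j < 1 / 2)
    (hcont : ∀ (k : ℕ) (s : ℕ → ℝ) (y : ι') (a : αι) (b : β) (x : (doubleCarriers C).Dom),
      ContinuousOn (fun p : ℂ × ((δ → ℝ) × (δ → ℂ)) => D.dir k s y a b x p.1 p.2.1 p.2.2)
        (sphere (0:ℂ) (D.r k) ×ˢ {q | OnContour D.κ₁ (D.cubes k y a b) q.1 q.2}))
    (hlip : ∀ g ∈ Wd, ∀ g' ∈ Wd, ∀ (k : ℕ) (y : ι'), ∀ a ∈ D.S0 k y, ∀ b ∈ D.SY k y a, ∀ (j : ℕ), ∀ x ∈ D.src k y a j,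
      ∀ t ∈ sphere (0:ℂ) (D.r k), ∀ (s' : δ → ℝ) (σ' : δ → ℂ), OnContour D.κ₁ (D.cubes k y a b) s' σ' →
        ‖D.dir k g y a b x t s' σ' - D.dir k g' y a b x t s' σ'‖ ≤ clipd * (cdir * ℓ k j * D.R x.1) * |g k - g' k|) :
    let Hc := H1LatticeCLM (lev₀ := lev₀) (levB := levB) φ hpos (QtorusW_surjective L m hL U hα1 hU1 hreg hαL φ) lev₁ (nabla115 η U)
    let Gc := frakGLatticeCLM (lev₀ := lev₀) φ hpos (QtorusW_surjective L m hL U hα1 hU1 hreg hαL φ) lev₁ (nabla115 η U)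
    let Cx := Cc L m η U lev₀ lev₁ (nabla115 η U) levB
    ‖Gc.comp (LJ ρ τc Hc Cx J)‖ < 1 →
    ∃ aC εC ε₄ Rb R' : ℝ, 0 < aC ∧ 0 < εC ∧ 0 < ε₄ ∧ 0 < Rb ∧ 0 < R' ∧
      Regime Hc 0 Cx ‖Hc‖ 0 (2097152 * ((d : ℝ) + 1) ^ 2) (1 / (512 * ((d : ℝ) + 1))) 0 aC εC ∧
      ∀ (ιr : C.Dom → (E →L[ℂ] NegSize (L : ℝ) η levB 0 𝔸)) (πr : C.Dom → (Space115 (L : ℝ) η lev₀ lev₁ (nabla115 η U) →L[ℂ] E)),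
        (∀ X, MapsTo (ιr X) (ball 0 (D.R X)) (ball 0 Rb)) → (∀ X, MapsTo (πr X) (ball 0 R') (ball 0 (R₁ X))) →
        let Ψ : C.Dom → E → E := fun X e => πr X (chartHB Gc (-(Gc.comp (LJ ρ τc Hc Cx J))) (W80 ρ τc U Hc Cx εC J Δπ) 0
          (fun A' => A' + solA Hc 0 Cx 0 εC A') ε₄ Hc (ιr X e))
        ∀ g ∈ Wd, ∀ g' ∈ Wd, ∀ (k : ℕ) (y : ι'), ∀ a ∈ (D.compCur Ψ R₁).toC.S0 k y, ∀ b ∈ (D.compCur Ψ R₁).toC.SY k y a,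
          ∀ (j : ℕ), ∀ x ∈ (D.compCur Ψ R₁).toC.src k y a j,
          |(D.compCur Ψ R₁).toC.piece k g y a b x (Ef g) - (D.compCur Ψ R₁).toC.piece k g' y a b x (Ef g)| ≤
            (D.compCur Ψ R₁).Kp cdir k y * (64 * (4 * clipd) * Nbar) * ℓ k j ^ 5 * Real.exp (-(κw * (doubleCarriers C).d x)) *
              Real.exp (-(1 / 8) * ((D.compCur Ψ R₁).κ₁ - 1) * (D.compCur Ψ R₁).toC.dY k y + (1 / 8) * (D.compCur Ψ R₁).κ₁ * d0 -
                (1 / 2) * ((D.compCur Ψ R₁).κ₁ - 1) * (D.compCur Ψ R₁).toC.vol k y a b) *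
                |g k - g' k| := by
  intro Hc Gc Cx hθ
  obtain ⟨aC, εC, ε₄, Rb, R', haC, hεC, hε₄, hRb, hR', RC, hΦ1, hΦ2, hΦ3⟩ :=
    cur_chart_exists_oneInstance L m hL φ τ lev₁ hlev U hα hα1 hU1 hreg hαL a hpos ρ τc hCV hRV hqV J Δπ hθ
  refine ⟨aC, εC, ε₄, Rb, R', haC, hεC, hε₄, hRb, hR', RC, fun ιr πr hιr hπr => ?_⟩
  exact cpieceResponse_compCur_of_chart hΦ1 hΦ2 hΦ3 ιr πr hιr hπr hD hdirB hE hT hN0 hNb hclipd hcdir hℓ hhalf hcont hlip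

/-! ## §3 T24 ∧ T25: the node fed by the instance with `hpos(U)` PRODUCED on the small-field set -/

set_option maxRecDepth 8192 in
/-- **THE NODE FED AT EVERY SMALL FIELD OF A FIXED LATTICE WITH NO DISPLAYED POSITIVITY** (desk T24 ∧ T25).  There is `ε₃ > 0` (a finite-lattice
number; the owner's `B9Thm311SmallFieldClosed.laplaceAofBackground_pos_of_small_field`, [Balaban1985BackgroundPropagators] Thm 3.11) such that for
EVERY background `U` of E162's data with `‖U(b) − 1‖ ≤ ε ≤ ε₃` and mutually adjoint transporters `hRS`, and all (L3) letters `ρ`, `τc`, V₀-slot `hqV`,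
`J`, `Δπ`: the positivity `hpos(U)` HOLDS (`∃ hpos`) and §2's conclusion holds at that `hpos` — with `H(U) := H1LatticeCLM φ hpos …`,
`𝔊(U) := frakGLatticeCLM φ hpos …`, `C(U) := Cc …`, whenever `‖𝔊(U) ∘L L_J‖ < 1` there are `a_C ε_C ε₄ R_b R′ > 0` with the Sect. C `Regime` and, for
ALL readings `ιr`, `πr` with the two ball inclusions, the conclusion of `NE9CurveFromBackgroundMap.cpieceResponse_compCur` for `D.compCur Ψ R₁`,
`Ψ X := πr X ∘ (one-instance chart with the J-term) ∘ ιr X`.  The END's binders (ray datum, (d1)–(d2), `hhalf`, window family, counts) are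
parameters, VERBATIM; displayed on the chart side: E162's data, `ε ≤ ε₃`, `hRS`, the fibre∕trace letters `M_φ, M_φ′, C_τ`, `0 < a`, the V₀-slot,
`‖𝔊(U) ∘L L_J‖ < 1` — NO positivity binder. [folklore] -/
theorem cpieceResponse_compCur_of_oneInstance_smallField {d : ℕ} (L : ℕ) [NeZero L] (m : Fin d → ℕ) [∀ i, NeZero (fineP L m i)]
    (hL : 1 ≤ L)
    {𝔸 : Type*} [NormedRing 𝔸] [NormedAlgebra ℂ 𝔸] [CompleteSpace 𝔸] [NormOneClass 𝔸] [StarRing 𝔸] [NormedStarGroup 𝔸] [StarModule ℂ 𝔸]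
    [FiniteDimensional ℂ 𝔸]
    {W : Type*} [NormedAddCommGroup W] [InnerProductSpace ℂ W] [FiniteDimensional ℂ W] (φ : W ≃ₗ[ℂ] 𝔸) {Mφ Mφ' : ℝ} (hMφ : 0 ≤ Mφ)
    (hMφ' : 0 ≤ Mφ') (hφ : ∀ w, ‖φ w‖ ≤ Mφ * ‖w‖) (hφ' : ∀ X, ‖φ.symm X‖ ≤ Mφ' * ‖X‖)
    (τ : 𝔸 →ₗ[ℂ] ℂ) {Cτ : ℝ} (hτ : ∀ X, ‖τ X‖ ≤ Cτ * ‖X‖) (hCτ : 0 ≤ Cτ)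
    {η : ℝ} [Fact (0 < (L : ℝ))] [Fact (0 < η)] {lev₀ : Bond d (fineP L m) → ℕ} {levB : Bond d m → ℕ} (lev₁ : Bond d (fineP L m) × Fin d → ℕ)
    (hlev : ∀ b, 1 ≤ lev₀ b) {c₀ c₁ : ℝ} [Fact (0 < c₀)] [Fact (0 < c₁)] {a : ℝ} (ha : 0 < a)
    -- the END's binders of `cpieceResponse_compCur`, verbatim (its `hpos` is `hdirB` here; its `W`, `κ`, `R'` are `Wd`, `κw`, `R₁`)
    {D : RemData C E ι' αι β γ δ} {R₁ : C.Dom → ℝ}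
    {ℓ : ℕ → ℕ → ℝ} {cdir d0 : ℝ} (hD : D.Admissible ℓ cdir d0) (hdirB : ∀ k s y a b x, 0 < D.dirB k s y a b x)
    {Ef : Functional (doubleCarriers C) E} {Wd : Set (ℕ → ℝ)} {κw : ℝ} {N : ℕ → ℝ} {Nbar clipd : ℝ}
    (hE : ∀ g ∈ Wd, Ef g ∈ analyticClass R₁) (hT : TermSize Ef Wd κw N) (hN0 : ∀ j, 0 ≤ N j) (hNb : ∀ j, N j ≤ Nbar)
    (hclipd : 0 ≤ clipd) (hcdir : 0 < cdir) (hℓ : ∀ k j, 0 < ℓ k j) (hhalf : ∀ k j, cdir * ℓ k j < 1 / 2)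
    (hcont : ∀ (k : ℕ) (s : ℕ → ℝ) (y : ι') (a : αι) (b : β) (x : (doubleCarriers C).Dom),
      ContinuousOn (fun p : ℂ × ((δ → ℝ) × (δ → ℂ)) => D.dir k s y a b x p.1 p.2.1 p.2.2)
        (sphere (0:ℂ) (D.r k) ×ˢ {q | OnContour D.κ₁ (D.cubes k y a b) q.1 q.2}))
    (hlip : ∀ g ∈ Wd, ∀ g' ∈ Wd, ∀ (k : ℕ) (y : ι'), ∀ a ∈ D.S0 k y, ∀ b ∈ D.SY k y a, ∀ (j : ℕ), ∀ x ∈ D.src k y a j,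
      ∀ t ∈ sphere (0:ℂ) (D.r k), ∀ (s' : δ → ℝ) (σ' : δ → ℂ), OnContour D.κ₁ (D.cubes k y a b) s' σ' →
        ‖D.dir k g y a b x t s' σ' - D.dir k g' y a b x t s' σ'‖ ≤ clipd * (cdir * ℓ k j * D.R x.1) * |g k - g' k|) :
    ∃ ε₃ : ℝ, 0 < ε₃ ∧ ∀ (U : Bond d (fineP L m) → 𝔸ˣ) {α : ℝ} (hα : α ≤ 1 / 128) (hα1 : α ≤ 1 / 64)
      (hU1 : ∀ (x : B7Prop1Explicit.Site d) (κ : Fin d), perCfg (fineP L m) U x κ ∈ U1 𝔸)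
      (hreg : ∀ (y : TSite d m) (κ : Fin d) (r : Fin d → Fin L),
        ‖((Wcx L (perCfg (fineP L m) U) (cornerSite L y) κ (boxVec L r) : 𝔸ˣ) : 𝔸) - 1‖ ≤ α)
      (hαL : 50 * (d + 1) * α * (L : ℝ) ^ d ≤ 1 / 2) {ε : ℝ}, 0 ≤ ε → ε ≤ ε₃ → (∀ b, ‖(U b : 𝔸) - 1‖ ≤ ε) →
      (∀ (b : Bond d (fineP L m)) (v u : W), inner ℂ (adTransportW φ U b v) u = inner ℂ v (adTransportW φ (fun b => (U b)⁻¹) b u)) →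
      ∀ (ρ : (𝔸 →L[ℂ] ℂ) →L[ℂ] 𝔸) (τc : 𝔸 →L[ℂ] ℂ) {CV RV : ℝ}, 0 ≤ CV → 0 < RV →
        (∀ Y : Space115 (L : ℝ) η lev₀ lev₁ (nabla115 η U), ‖Y‖ < RV →
          ‖curV0 (lev₁ := lev₁) (Dc := nabla115 η U) ρ τc U Y‖ ≤ CV * ‖Y‖ ^ 2) →
      ∀ (J : NegSize (L : ℝ) η lev₀ 3 𝔸) (Δπ : Space115 (L : ℝ) η lev₀ lev₁ (nabla115 η U) →L[ℂ] NegSize (L : ℝ) η lev₀ 3 𝔸),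
      ∃ hpos : ∀ x : BondL2K ℂ d (fineP L m) c₀ W, x ≠ 0 →
          0 < RCLike.re (inner ℂ x (laplaceAofBackground L m hL φ U hα1 hU1 hreg τ η (c₀ := c₀) (c₁ := c₁) a x)),
      let Hc := H1LatticeCLM (lev₀ := lev₀) (levB := levB) φ hpos (QtorusW_surjective L m hL U hα1 hU1 hreg hαL φ) lev₁ (nabla115 η U)
      let Gc := frakGLatticeCLM (lev₀ := lev₀) φ hpos (QtorusW_surjective L m hL U hα1 hU1 hreg hαL φ) lev₁ (nabla115 η U)
      let Cx := Cc L m η U lev₀ lev₁ (nabla115 η U) levB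
      ‖Gc.comp (LJ ρ τc Hc Cx J)‖ < 1 →
      ∃ aC εC ε₄ Rb R' : ℝ, 0 < aC ∧ 0 < εC ∧ 0 < ε₄ ∧ 0 < Rb ∧ 0 < R' ∧
        Regime Hc 0 Cx ‖Hc‖ 0 (2097152 * ((d : ℝ) + 1) ^ 2) (1 / (512 * ((d : ℝ) + 1))) 0 aC εC ∧
        ∀ (ιr : C.Dom → (E →L[ℂ] NegSize (L : ℝ) η levB 0 𝔸)) (πr : C.Dom → (Space115 (L : ℝ) η lev₀ lev₁ (nabla115 η U) →L[ℂ] E)),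
          (∀ X, MapsTo (ιr X) (ball 0 (D.R X)) (ball 0 Rb)) → (∀ X, MapsTo (πr X) (ball 0 R') (ball 0 (R₁ X))) →
          let Ψ : C.Dom → E → E := fun X e => πr X (chartHB Gc (-(Gc.comp (LJ ρ τc Hc Cx J))) (W80 ρ τc U Hc Cx εC J Δπ) 0
            (fun A' => A' + solA Hc 0 Cx 0 εC A') ε₄ Hc (ιr X e))
          ∀ g ∈ Wd, ∀ g' ∈ Wd, ∀ (k : ℕ) (y : ι'), ∀ a ∈ (D.compCur Ψ R₁).toC.S0 k y, ∀ b ∈ (D.compCur Ψ R₁).toC.SY k y a,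
            ∀ (j : ℕ), ∀ x ∈ (D.compCur Ψ R₁).toC.src k y a j,
            |(D.compCur Ψ R₁).toC.piece k g y a b x (Ef g) - (D.compCur Ψ R₁).toC.piece k g' y a b x (Ef g)| ≤
              (D.compCur Ψ R₁).Kp cdir k y * (64 * (4 * clipd) * Nbar) * ℓ k j ^ 5 * Real.exp (-(κw * (doubleCarriers C).d x)) *
                Real.exp (-(1 / 8) * ((D.compCur Ψ R₁).κ₁ - 1) * (D.compCur Ψ R₁).toC.dY k y + (1 / 8) * (D.compCur Ψ R₁).κ₁ * d0 -
                  (1 / 2) * ((D.compCur Ψ R₁).κ₁ - 1) * (D.compCur Ψ R₁).toC.vol k y a b) *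
                  |g k - g' k| := by
  obtain ⟨ε₃, hε₃, H⟩ := cur_chart_exists_oneInstance_smallField L m hL φ hMφ hMφ' hφ hφ' τ hτ hCτ (η := η) (lev₀ := lev₀)
    (levB := levB) lev₁ hlev (c₀ := c₀) (c₁ := c₁) ha
  refine ⟨ε₃, hε₃, fun U α hα hα1 hU1 hreg hαL ε hε hεε₃ hUε hRS ρ τc CV RV hCV hRV hqV J Δπ => ?_⟩
  obtain ⟨hpos, -⟩ := H U hα hα1 hU1 hreg hαL hε hεε₃ hUε hRS ρ τc hCV hRV hqV J Δπ
  exact ⟨hpos, cpieceResponse_compCur_of_oneInstance L m hL φ τ lev₁ hlev U hα hα1 hU1 hreg hαL a hpos ρ τc hCV hRV hqV J Δπ hD hdirB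
    hE hT hN0 hNb hclipd hcdir hℓ hhalf hcont hlip⟩

/-! ## §4 (v1.1, gen 68, APPEND-ONLY) THE NODE FED ON ONE PAIR OF BALLS FOR THE WHOLE SMALL-FIELD FAMILY AND ALL SMALL CURRENTS -/

section UniformBall

open Summit.QuantumFields.BalabanUV.T4Continuum.NE9CurChartOneInstanceUniformBall (cur_chart_exists_oneInstance_smallField_uniform_smallJ)

set_option maxRecDepth 8192 in
/-- **THE NODE FED WITH THE READINGS CHOSEN AGAINST FIXED RADII** (§3 with the chart radii BEFORE `∀ U`, by this lineage's gen-68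
`NE9CurChartOneInstanceUniformBall.cur_chart_exists_oneInstance_smallField_uniform_smallJ`).  Given the fibre∕trace letters, `0 < a`, the fixed (L3)
operators `ρ`, `τc`, V₀-slot letters `C_V ≥ 0`, `R_V > 0`, current bounds `M_J > 0`, `M_Δ ≥ 0`, and the END's binders of
`NE9CurveFromBackgroundMap.cpieceResponse_compCur` VERBATIM (ray datum `D.Admissible`, `0 < dirB`, window family `Ef` analytic on the `R₁`-balls with
(1.18) `TermSize`, counts, `hhalf`, (d1) `hcont`, (d2) `hlip`): THERE ARE `ε₃ > 0`, T-slot radii `a_C, ε_C > 0`, chart radii `ε₄, R_b, R′ > 0` and a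
current threshold `0 < j₁ ≤ M_J` — finite-lattice numbers, ALL BEFORE `∀ U` — such that for EVERY background `U` of E162's data with
`‖U(b) − 1‖ ≤ ε ≤ ε₃`, `hRS`, the V₀-group's slot at `(C_V, R_V)`, ALL currents `J`, `Δπ` with `‖J‖₍₋₃₎ ≤ j₁`, `‖Δπ‖ ≤ M_Δ`: `hpos(U)` HOLDS and for
ALL per-domain readings `ιr X : E →L[ℂ] |·|_{(−0)}`, `πr X : (115) →L[ℂ] E` with `ιr X (ball 0 (D.R X)) ⊆ ball 0 R_b`, `πr X (ball 0 R′) ⊆ ball 0 (R₁ X)`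
— inclusions against the FIXED `R_b, R′`, so the `ιr` side can be chosen ONCE for the family — the conclusion of
`NE9CurveFromBackgroundMap.cpieceResponse_compCur` holds for `D.compCur Ψ R₁`, `Ψ X := πr X ∘ (one-instance chart of `cur U` with the J-term) ∘ ιr X`.
No positivity binder, no `‖𝔊(U) ∘L L_J‖ < 1`, no U-dependent radius displayed; per LATTICE. [folklore] -/
theorem cpieceResponse_compCur_of_oneInstance_uniform_smallJ {d : ℕ} (L : ℕ) [NeZero L] (m : Fin d → ℕ) [∀ i, NeZero (fineP L m i)]
    (hL : 1 ≤ L)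
    {𝔸 : Type*} [NormedRing 𝔸] [NormedAlgebra ℂ 𝔸] [CompleteSpace 𝔸] [NormOneClass 𝔸] [StarRing 𝔸] [NormedStarGroup 𝔸] [StarModule ℂ 𝔸]
    [FiniteDimensional ℂ 𝔸]
    {W : Type*} [NormedAddCommGroup W] [InnerProductSpace ℂ W] [FiniteDimensional ℂ W] (φ : W ≃ₗ[ℂ] 𝔸) {Mφ Mφ' : ℝ} (hMφ : 0 ≤ Mφ)
    (hMφ' : 0 ≤ Mφ') (hφ : ∀ w, ‖φ w‖ ≤ Mφ * ‖w‖) (hφ' : ∀ X, ‖φ.symm X‖ ≤ Mφ' * ‖X‖)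
    (τ : 𝔸 →ₗ[ℂ] ℂ) {Cτ : ℝ} (hτ : ∀ X, ‖τ X‖ ≤ Cτ * ‖X‖) (hCτ : 0 ≤ Cτ)
    {η : ℝ} [Fact (0 < (L : ℝ))] [Fact (0 < η)] {lev₀ : Bond d (fineP L m) → ℕ} {levB : Bond d m → ℕ} (lev₁ : Bond d (fineP L m) × Fin d → ℕ)
    (hlev : ∀ b, 1 ≤ lev₀ b) {c₀ c₁ : ℝ} [Fact (0 < c₀)] [Fact (0 < c₁)] {a : ℝ} (ha : 0 < a)
    (ρ : (𝔸 →L[ℂ] ℂ) →L[ℂ] 𝔸) (τc : 𝔸 →L[ℂ] ℂ) {CV RV MJ MΔ : ℝ} (hCV : 0 ≤ CV) (hRV : 0 < RV) (hMJ : 0 < MJ) (hMΔ : 0 ≤ MΔ)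
    -- the END's binders of `cpieceResponse_compCur`, verbatim (its `hpos` is `hdirB` here; its `W`, `κ`, `R'` are `Wd`, `κw`, `R₁`)
    {D : RemData C E ι' αι β γ δ} {R₁ : C.Dom → ℝ}
    {ℓ : ℕ → ℕ → ℝ} {cdir d0 : ℝ} (hD : D.Admissible ℓ cdir d0) (hdirB : ∀ k s y a b x, 0 < D.dirB k s y a b x)
    {Ef : Functional (doubleCarriers C) E} {Wd : Set (ℕ → ℝ)} {κw : ℝ} {N : ℕ → ℝ} {Nbar clipd : ℝ}
    (hE : ∀ g ∈ Wd, Ef g ∈ analyticClass R₁) (hT : TermSize Ef Wd κw N) (hN0 : ∀ j, 0 ≤ N j) (hNb : ∀ j, N j ≤ Nbar)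
    (hclipd : 0 ≤ clipd) (hcdir : 0 < cdir) (hℓ : ∀ k j, 0 < ℓ k j) (hhalf : ∀ k j, cdir * ℓ k j < 1 / 2)
    (hcont : ∀ (k : ℕ) (s : ℕ → ℝ) (y : ι') (a : αι) (b : β) (x : (doubleCarriers C).Dom),
      ContinuousOn (fun p : ℂ × ((δ → ℝ) × (δ → ℂ)) => D.dir k s y a b x p.1 p.2.1 p.2.2)
        (sphere (0:ℂ) (D.r k) ×ˢ {q | OnContour D.κ₁ (D.cubes k y a b) q.1 q.2}))
    (hlip : ∀ g ∈ Wd, ∀ g' ∈ Wd, ∀ (k : ℕ) (y : ι'), ∀ a ∈ D.S0 k y, ∀ b ∈ D.SY k y a, ∀ (j : ℕ), ∀ x ∈ D.src k y a j,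
      ∀ t ∈ sphere (0:ℂ) (D.r k), ∀ (s' : δ → ℝ) (σ' : δ → ℂ), OnContour D.κ₁ (D.cubes k y a b) s' σ' →
        ‖D.dir k g y a b x t s' σ' - D.dir k g' y a b x t s' σ'‖ ≤ clipd * (cdir * ℓ k j * D.R x.1) * |g k - g' k|) :
    ∃ ε₃ aC εC ε₄ Rb R' j₁ : ℝ, 0 < ε₃ ∧ 0 < aC ∧ 0 < εC ∧ 0 < ε₄ ∧ 0 < Rb ∧ 0 < R' ∧ 0 < j₁ ∧ j₁ ≤ MJ ∧
      ∀ (U : Bond d (fineP L m) → 𝔸ˣ) {α : ℝ} (hα : α ≤ 1 / 128) (hα1 : α ≤ 1 / 64)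
        (hU1 : ∀ (x : B7Prop1Explicit.Site d) (κ : Fin d), perCfg (fineP L m) U x κ ∈ U1 𝔸)
        (hreg : ∀ (y : TSite d m) (κ : Fin d) (r : Fin d → Fin L),
          ‖((Wcx L (perCfg (fineP L m) U) (cornerSite L y) κ (boxVec L r) : 𝔸ˣ) : 𝔸) - 1‖ ≤ α)
        (hαL : 50 * (d + 1) * α * (L : ℝ) ^ d ≤ 1 / 2) {ε : ℝ}, 0 ≤ ε → ε ≤ ε₃ → (∀ b, ‖(U b : 𝔸) - 1‖ ≤ ε) →
        (∀ (b : Bond d (fineP L m)) (v u : W), inner ℂ (adTransportW φ U b v) u = inner ℂ v (adTransportW φ (fun b => (U b)⁻¹) b u)) →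
        (∀ Y : Space115 (L : ℝ) η lev₀ lev₁ (nabla115 η U), ‖Y‖ < RV →
          ‖curV0 (lev₁ := lev₁) (Dc := nabla115 η U) ρ τc U Y‖ ≤ CV * ‖Y‖ ^ 2) →
      ∀ (J : NegSize (L : ℝ) η lev₀ 3 𝔸) (Δπ : Space115 (L : ℝ) η lev₀ lev₁ (nabla115 η U) →L[ℂ] NegSize (L : ℝ) η lev₀ 3 𝔸),
        ‖J‖ ≤ j₁ → ‖Δπ‖ ≤ MΔ →
      ∃ hpos : ∀ x : BondL2K ℂ d (fineP L m) c₀ W, x ≠ 0 →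
          0 < RCLike.re (inner ℂ x (laplaceAofBackground L m hL φ U hα1 hU1 hreg τ η (c₀ := c₀) (c₁ := c₁) a x)),
      let Hc := H1LatticeCLM (lev₀ := lev₀) (levB := levB) φ hpos (QtorusW_surjective L m hL U hα1 hU1 hreg hαL φ) lev₁ (nabla115 η U)
      let Gc := frakGLatticeCLM (lev₀ := lev₀) φ hpos (QtorusW_surjective L m hL U hα1 hU1 hreg hαL φ) lev₁ (nabla115 η U)
      let Cx := Cc L m η U lev₀ lev₁ (nabla115 η U) levB
      ∀ (ιr : C.Dom → (E →L[ℂ] NegSize (L : ℝ) η levB 0 𝔸)) (πr : C.Dom → (Space115 (L : ℝ) η lev₀ lev₁ (nabla115 η U) →L[ℂ] E)),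
        (∀ X, MapsTo (ιr X) (ball 0 (D.R X)) (ball 0 Rb)) → (∀ X, MapsTo (πr X) (ball 0 R') (ball 0 (R₁ X))) →
        let Ψ : C.Dom → E → E := fun X e => πr X (chartHB Gc (-(Gc.comp (LJ ρ τc Hc Cx J))) (W80 ρ τc U Hc Cx εC J Δπ) 0
          (fun A' => A' + solA Hc 0 Cx 0 εC A') ε₄ Hc (ιr X e))
        ∀ g ∈ Wd, ∀ g' ∈ Wd, ∀ (k : ℕ) (y : ι'), ∀ a ∈ (D.compCur Ψ R₁).toC.S0 k y, ∀ b ∈ (D.compCur Ψ R₁).toC.SY k y a,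
          ∀ (j : ℕ), ∀ x ∈ (D.compCur Ψ R₁).toC.src k y a j,
          |(D.compCur Ψ R₁).toC.piece k g y a b x (Ef g) - (D.compCur Ψ R₁).toC.piece k g' y a b x (Ef g)| ≤
            (D.compCur Ψ R₁).Kp cdir k y * (64 * (4 * clipd) * Nbar) * ℓ k j ^ 5 * Real.exp (-(κw * (doubleCarriers C).d x)) *
              Real.exp (-(1 / 8) * ((D.compCur Ψ R₁).κ₁ - 1) * (D.compCur Ψ R₁).toC.dY k y + (1 / 8) * (D.compCur Ψ R₁).κ₁ * d0 -
                (1 / 2) * ((D.compCur Ψ R₁).κ₁ - 1) * (D.compCur Ψ R₁).toC.vol k y a b) *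
                |g k - g' k| := by
  obtain ⟨ε₃, aC, εC, a₃, C₄, ε₄, Rb, R', j₁, hε₃, haC, hεC, -, -, hε₄, hRb, hR', hj₁, hj₁M, H⟩ :=
    cur_chart_exists_oneInstance_smallField_uniform_smallJ L m hL φ hMφ hMφ' hφ hφ' τ hτ hCτ (η := η) (lev₀ := lev₀) (levB := levB) lev₁ hlev
      (c₀ := c₀) (c₁ := c₁) ha ρ τc hCV hRV hMJ hMΔ
  refine ⟨ε₃, aC, εC, ε₄, Rb, R', j₁, hε₃, haC, hεC, hε₄, hRb, hR', hj₁, hj₁M, ?_⟩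
  intro U α hα hα1 hU1 hreg hαL ε hε hεε₃ hUε hRS hqV J Δπ hJ hΔ
  obtain ⟨hpos, hmain⟩ := H U hα hα1 hU1 hreg hαL hε hεε₃ hUε hRS hqV J Δπ hJ hΔ
  refine ⟨hpos, ?_⟩
  intro Hc Gc Cx ιr πr hιr hπr
  obtain ⟨-, -, hΦ1, hΦ2, hΦ3⟩ := hmain
  exact cpieceResponse_compCur_of_chart hΦ1 hΦ2 hΦ3 ιr πr hιr hπr hD hdirB hE hT hN0 hNb hclipd hcdir hℓ hhalf hcont hlip

end UniformBall

end Summit.QuantumFields.BalabanUV.T4Continuum.NE9CurOfOneInstanceChart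

end
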